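import Summits.Ventures.HodgeKum4.Theorems.KummerFixedLocusCoinvariantsLLVTrivial
import Summits.Ventures.HodgeKum4.Theorems.KummerFixedLocusOrbitSpan
import Summits.Ventures.HodgeKum4.Theorems.KummerFixedLocusInvolutionTrace
import Mathlib.Tactic.Abel
import Summits.Ventures.HodgeKum4.Theorems.KummerFixedLocusTranslationGroup
import HarnessLib

/-!
# `H*(X(ℂ); ℂ) = H*^{Γ} ⊕ 𝒦_tot` for `Kum⁴`-type `X` (cell `hodge-kum4`, seat p2 — service lemma for seat p1)

HONEST FRAMING.  Bookkeeping, PROVED modulo the route's print inputs taken as hypotheses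
(`Kum4TranslationGroupTrivialOffMiddle` = Foster Rmk. 88, F_Γ′; `GammaFiniteKum4` ⇐ F_Γ): the total
cohomology of a smooth projective `Kum⁴`-type `X` is the direct sum of the `Γ(X)`-invariant classes
`gammaInvariantClasses X` and the total coinvariant kernel `𝒦_tot = coinvariantsKerTotal X` (the image of
`𝒦 = ker(H⁸ → H⁸_Γ)` in `H*`; Maschke averaging in degree `8`, triviality of `Γ(X)` off degree `8`).
Together with `degreeOperator_apply_of_mem` and `totalLefschetz_apply_of_mem`
(`KummerFixedLocusCoinvariantsLLVTrivial`) this supplies the complement clauses of seat p1's model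
hypothesis MODEL_X (director ruling 2026-08-25T23:57:53Z (2): the named input is to be minimal).
-/

noncomputable section

open CategoryTheory DirectSum Representation
open Literature.AlgebraicTopology.SingularHomology
open Literature.AlgebraicGeometry Literature.AlgebraicGeometry.HodgeTheory
open Literature.AlgebraicGeometry.Hyperkaehler (translationRep IsOfGeneralizedKummerType totalCohomology ofDegree)

namespace Summit.Ventures.HodgeKum4

variable {X : Motives.SchemeOver ℂ}

/-- A class of `Hᵏ(X(ℂ); ℂ)` is fixed by the representation `translationRep X k` (`g ↦ (g⁻¹)^*`) iff it is
`Γ(X)`-invariant in the degreewise sense `IsGammaInvariant`. -/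
theorem mem_invariants_translationRep_iff {k : ℕ} (c : complexBetti X k) :
    c ∈ (translationRep X k).invariants ↔ IsGammaInvariant X c := by
  rw [Representation.mem_invariants]
  constructor
  · intro h g hg
    have h' := h ⟨g, hg⟩⁻¹
    simpa [translationRep] using h'
  · intro h g
    exact h _ (g⁻¹).property

/-- `V = V^G ⊕ 𝒦(ρ)` for a finite group over `ℂ` (Reynolds averaging; the `Signature` module has the
same lemma over ordered fields). -/
theorem isCompl_invariants_coinvariantsKer_complex {G V : Type*} [Group G] [Fintype G]
    [AddCommGroup V] [Module ℂ V] (ρ : Representation ℂ G V) :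
    IsCompl ρ.invariants (Coinvariants.ker ρ) := by
  letI : Invertible (Fintype.card G : ℂ) :=
    invertibleOfNonzero (by exact_mod_cast Fintype.card_ne_zero)
  refine isCompl_iff.2 ⟨Submodule.disjoint_def.2 fun x hxU hxK => ?_,
    codisjoint_iff.2 (eq_top_iff.2 fun x _ => ?_)⟩
  · have h1 : ρ.averageMap x = x := ρ.averageMap_id x hxU
    have h2 : ρ.averageMap x = 0 := by
      have h3 : ρ.averageMap x = ⅟(Fintype.card G : ℂ) • (∑ g : G, ρ g) x := by
        simp [GroupAlgebra.average, map_sum, LinearMap.sum_apply]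
      rw [h3, OrbitSpan.sum_apply_eq_zero_of_mem_coinvariantsKer ρ hxK, smul_zero]
    rw [← h1, h2]
  · have hx : x = ρ.averageMap x + (x - ρ.averageMap x) := by abel
    rw [hx]
    exact Submodule.add_mem_sup (ρ.averageMap_invariant x) (OrbitSpan.sub_averageMap_mem_coinvariantsKer ρ x)

/-- **`H*(X(ℂ); ℂ) = H*(X(ℂ); ℂ)^{Γ(X)} ⊕ 𝒦_tot`** for `X` smooth projective of `Kum⁴`-type, granted
that `Γ(X)` is finite and acts trivially off degree `8`. -/
theorem isCompl_gammaInvariantClasses_coinvariantsKerTotal (hfin : GammaFiniteKum4)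
    (hoff : Kum4TranslationGroupTrivialOffMiddle) (hX : Motives.IsSmoothProjective 8 X)
    (hK : IsOfGeneralizedKummerType 4 X) :
    IsCompl (gammaInvariantClasses X) (coinvariantsKerTotal X) := by
  classical
  haveI : Finite (Literature.AlgebraicGeometry.Hyperkaehler.autFixingH2H3 X) := by
    rw [← autFixingH2H3_eq_literature]; exact hfin hX hK
  letI : Fintype (Literature.AlgebraicGeometry.Hyperkaehler.autFixingH2H3 X) := Fintype.ofFinite _
  have h8 : IsCompl (translationRep X 8).invariants (Coinvariants.ker (translationRep X 8)) :=
    isCompl_invariants_coinvariantsKer_complex (translationRep X 8)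
  refine isCompl_iff.2 ⟨Submodule.disjoint_def.2 fun v hvI hvK => ?_,
    codisjoint_iff.2 (eq_top_iff.2 fun v _ => ?_)⟩
  · -- `v = ofDegree 8 y` with `y ∈ 𝒦` and `y` invariant, so `y = 0`
    obtain ⟨y, hy, rfl⟩ := hvK
    have hyI : y ∈ (translationRep X 8).invariants :=
      (mem_invariants_translationRep_iff y).2 (isGammaInvariant_of_ofDegree_mem hvI)
    have hy0 : y = 0 := Submodule.disjoint_def.1 h8.disjoint y hyI hy
    rw [hy0, map_zero]
  · -- decompose `v` into its homogeneous components
    have hv' : v = ∑ i ∈ v.support, ofDegree ℂ (Motives.ComplexPoints X) i (v i) :=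
      (DirectSum.sum_support_of v).symm
    rw [hv']
    refine Submodule.sum_mem _ fun i _ => ?_
    by_cases hi : i = 8
    · subst hi
      -- degree 8: Maschke splitting `H⁸ = (H⁸)^Γ ⊕ 𝒦`
      obtain ⟨u, hu, y, hy, huy⟩ := Submodule.mem_sup.1 (h8.sup_eq_top ▸ Submodule.mem_top : v 8 ∈ _)
      rw [← huy, map_add]
      refine Submodule.add_mem_sup ?_ ?_
      · exact ofDegree_mem_gammaInvariantClasses ((mem_invariants_translationRep_iff u).1 hu)
      · exact Submodule.mem_map_of_mem hy
    · -- other degrees: every class is invariant (F_Γ′)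
      refine Submodule.mem_sup_left (ofDegree_mem_gammaInvariantClasses fun g hg => ?_)
      rw [hoff hX hK i hi g hg]
      rfl

/-- The same with the two print inputs supplied from the Literature facts
(`Floccari2026_card_autFixingH2H3_kum4Type`, `Foster2024_translationAction_kum4Type`). -/
theorem isCompl_gammaInvariantClasses_coinvariantsKerTotal_of_literature
    (h₁ : Literature.AlgebraicGeometry.Hyperkaehler.Floccari2026_card_autFixingH2H3_kum4Type)
    (h₂ : Literature.AlgebraicGeometry.Hyperkaehler.Foster2024_translationAction_kum4Type)
    (hX : Motives.IsSmoothProjective 8 X) (hK : IsOfGeneralizedKummerType 4 X) :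
    IsCompl (gammaInvariantClasses X) (coinvariantsKerTotal X) :=
  isCompl_gammaInvariantClasses_coinvariantsKerTotal (gammaFinite_of_literature h₁)
    (kum4TranslationGroupTrivialOffMiddle_of_literature h₂) hX hK

end Summit.Ventures.HodgeKum4

end
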